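import Mathlib
import HarnessLib
import Summits.Langlands.Langlands.Theses.SkinnerWilesDefectOne
import Summits.Langlands.Langlands.Theorems.ReducibleOrdinaryProModular.Negative.LevelAndRamification
import Literature.NumberTheory.GaloisRepresentations.NearlyOrdinaryDeformationRing
import Literature.NumberTheory.GaloisRepresentations.NearlyOrdinaryDeformationRingProofs
import Literature.NumberTheory.GaloisRepresentations.PadicIntermediateFieldIntegers
import Summits.Langlands.Langlands.Theorems.SkinnerWilesDefectOneReducibleOrdinaryProModularDefs
import Summits.Langlands.Langlands.Theorems.SkinnerWilesDefectOneReducibleOrdinaryProModularOrientedSteinbergDatumDatumAux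

/-! # The Skinner–Wiles oriented datum at level `S♯ ∪ {v₀}`: stub `stub_orientedSteinbergDatum` of line
steinberg-hyperplane (crux ReducibleOrdinaryProModular, stmt-Langlands-12919)

From the crux data — `F` imaginary quadratic, `p` odd, `ρ : Γ_F → GL₂(ℚ̄_p)` continuous, irreducible, almost
everywhere unramified, with an integral model `ρ₀` over the valuation ring `O` of `ℚ̄_p` that is upper triangular
modulo `𝔪_O` (residual diagonal `(χ̄_a, χ̄_b)`), `p`-distinguished and Skinner–Wiles ORIENTED ordinary at every
`v ∣ p` (`OrdLoc`) — and a place `v₀`, we construct `M : ModelData F p` with `M.Models ρ ρ₀ (baseLevel ρ ∪ {v₀})`: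

1. (`…RibetAux`, `…EndLatticeAux`) all entries of `ρ` lie in a finite `E/ℚ_p` (Baire); Ribet's end lattice
   `T = (1 s; 0 ϖⁿ)`: `T ρ T⁻¹` is `𝒪_E`-integral, residually upper triangular with the ordered residual diagonal of
   `ρ₀`, residually NON-SPLIT; the orientation `‖Q₀₀‖ ≤ ‖Q₁₀‖` is lattice-free (the ordinary line reduces to the
   `χ̄_b`-eigenline), giving integral oriented ordinary vectors `(x_v, 1)` at `v ∣ p`;
2. (`…DatumAux`) descent to `ρ_E : Γ_F → GL₂(𝒪_E)` and the residual datum `𝒟 = (S♯ ∪ {v₀}, ρ̄_E, (x_v 1; 1 0)_v)`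
   with scalar centralizer (Berger–Klosin Lemma 28), `p`-distinguished, oriented, `ρ_E` a deformation of type `𝒟`;
3. (here) `𝒪 = 𝒪_E` is a complete DVR of characteristic `0` with finite residue field of characteristic `p`; the
   universal nearly ordinary deformation ring `𝓡` of `𝒟` EXISTS for any `p` (the tree's PROVED
   `NearlyOrdinaryDatum.nonempty_rigidData`, `RigidData.finite_carrier_dualCNL`, `RigidData.nonempty_deformationRing`
   — Calegari–Mazur §2.2 via Mazur's representability criterion; the splitting hypothesis of the named fact
   `nearlyOrdinaryDeformationRing_nonempty` is not needed); universality applied to `ρ_E` gives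
   `φ : 𝓡.R → 𝒪_E → ℚ̄_p` with `GL₂(φ) ∘ ρ_𝒟` strictly equivalent to `ρ_E`, whence `realizes`.

`v₀` enters only through the finiteness of `S♯ ∪ {v₀}` (the Taylor–Steinberg hypothesis is not used).

References: Skinner–Wiles, Publ. Math. IHÉS 89 (1999), §2.1, §4.6; Calegari–Mazur, J. Inst. Math. Jussieu 8 (2009),
§2.2; Ribet, Invent. Math. 34 (1976), Prop. 2.1; Berger–Klosin, Math. Ann. 355 (2013), Lemma 28.
-/

set_option linter.dupNamespace false
set_option autoImplicit false

namespace Summit.Langlands.Langlands.Cruxes.ReducibleOrdinaryProModular.SteinbergHyperplane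

open scoped NumberField MatrixGroups
open Filter NumberField IsDedekindDomain Field Polynomial Matrix
open Literature.NumberTheory.Automorphic Literature.NumberTheory.Automorphic.BigHeckeGLn
open Literature.NumberTheory.GaloisRepresentations
open Summit.Langlands.Langlands.Theses.SkinnerWilesDefectOne

noncomputable section

namespace OrientedDatum

variable {p : ℕ} [Fact p.Prime]

/-- `𝒪_E` is a discrete valuation ring (principal, local, not a field). [folklore] -/
theorem isDiscreteValuationRing_integers (E : IntermediateField ℚ_[p] (PadicAlgCl p)) [FiniteDimensional ℚ_[p] E] :
    IsDiscreteValuationRing (intermediateFieldIntegers p E) :=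
  { not_a_field' := intermediateFieldIntegers.maximalIdeal_ne_bot E }

/-- The residue field `k_E` has characteristic `p`. [folklore] -/
theorem charP_residueField_integers (E : IntermediateField ℚ_[p] (PadicAlgCl p)) :
    CharP (IsLocalRing.ResidueField (intermediateFieldIntegers p E)) p := by
  rw [CharP.charP_iff_prime_eq_zero (Fact.out : p.Prime),
    ← map_natCast (IsLocalRing.residue (intermediateFieldIntegers p E)) p, IsLocalRing.residue_eq_zero_iff]
  exact intermediateFieldIntegers.natCast_mem_maximalIdeal E

/-- The base level `S♯ = {v ∣ p} ∪ Ram(ρ)` of an almost everywhere unramified `ρ`, augmented by `v₀`, is finite.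
[folklore] -/
theorem finite_baseLevel_union {F : Type} [Field F] [NumberField F] (ρ : FramedGaloisRep F (PadicAlgCl p) 2)
    (hunr : ∀ᶠ v in cofinite, ρ.IsUnramifiedAt v) (v₀ : HeightOneSpectrum (𝓞 F)) :
    (baseLevel ρ ∪ {v₀}).Finite := by
  refine Set.Finite.union (Set.Finite.union ?_ (Filter.eventually_cofinite.1 hunr)) (Set.finite_singleton v₀)
  exact Set.finite_coe_iff.mp (finite_placesAbove (p := p) F)

end OrientedDatum

/-- **The Skinner–Wiles oriented datum at level `S♯ ∪ {v₀}`** (stub `stub_orientedSteinbergDatum` of line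
steinberg-hyperplane): from the crux data and a place `v₀`, a model `M : ModelData F p` — coefficient ring `𝒪_E`
for a finite `E/ℚ_p`, Ribet's non-split end lattice with the ordered residual diagonal of `ρ₀` and oriented ordinary
frames at `v ∣ p`, the universal nearly ordinary deformation ring of the resulting datum (Calegari–Mazur §2.2, any
`p`) and the specialisation classifying the lattice — with `M.Models ρ ρ₀ (baseLevel ρ ∪ {v₀})`.
[cite: SkinnerWiles1999, §2.1] -/
theorem stub_orientedSteinbergDatum :
    ∀ (F : Type) [Field F] [NumberField F], IsTotallyComplex F → Module.finrank ℚ F = 2 →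
      ∀ (p : ℕ) [Fact p.Prime], p ≠ 2 →
      ∀ (O : ValuationSubring (PadicAlgCl p)),
        O = (Valued.v : Valuation (PadicAlgCl p) NNReal).valuationSubring →
      ∀ (ρ : FramedGaloisRep F (PadicAlgCl p) 2) (ρ₀ : absoluteGaloisGroup F →* GL (Fin 2) O),
        ρ.toGaloisRep.IsIrreducible → (∀ᶠ v in cofinite, ρ.IsUnramifiedAt v) →
        ρ.HasUpperTriangularIntegralModel ρ₀ → OrdLoc p O ρ ρ₀ →
        ∀ v₀ : HeightOneSpectrum (𝓞 F), TaylorSteinbergPlace p ρ ρ₀ v₀ →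
          ∃ M : ModelData F p, M.Models ρ ρ₀ (baseLevel ρ ∪ {v₀}) := by
  intro F _ _ _ _ p _ _ O hO ρ ρ₀ hirr hunr hint hloc v₀ _
  obtain ⟨E, hEfin, 𝒟, ρE, T, hS, hup, hdiag, hsc, hdist, hor, hdef, hρE⟩ :=
    OrientedDatum.datum_exists hO ρ ρ₀ hirr hint hloc (baseLevel ρ ∪ {v₀})
      (OrientedDatum.finite_baseLevel_union ρ hunr v₀) Set.subset_union_left
  haveI := hEfin
  haveI : Finite (IsLocalRing.ResidueField (intermediateFieldIntegers p E)) :=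
    intermediateFieldIntegers.finite_residueField E
  haveI : IsDiscreteValuationRing (intermediateFieldIntegers p E) := OrientedDatum.isDiscreteValuationRing_integers E
  haveI : CharP (IsLocalRing.ResidueField (intermediateFieldIntegers p E)) p :=
    OrientedDatum.charP_residueField_integers E
  -- the universal nearly ordinary deformation ring of `𝒟` (Calegari–Mazur §2.2, any `p`)
  obtain ⟨RD⟩ := 𝒟.nonempty_rigidData (Fact.out : p.Prime) hsc hdist
  obtain ⟨𝓡⟩ := RD.nonempty_deformationRing (RD.finite_carrier_dualCNL 𝒟.residueMap_surjective)
  -- the specialisation classifying `ρ_E`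
  have hsurj : Function.Surjective
      (Algebra.ofId (intermediateFieldIntegers p E) (IsLocalRing.ResidueField (intermediateFieldIntegers p E))) :=
    fun x => by
      obtain ⟨y, hy⟩ := IsLocalRing.residue_surjective x
      exact ⟨y, hy⟩
  obtain ⟨φ, ⟨P, -, hP⟩, -⟩ := 𝓡.universal (intermediateFieldIntegers p E) (Algebra.ofId _ _) hsurj ρE hdef
  set emb : intermediateFieldIntegers p E →+* PadicAlgCl p :=
    (algebraMap E (PadicAlgCl p)).comp (intermediateFieldIntegers p E).subtype with hemb
  refine ⟨{ 𝒪 := intermediateFieldIntegers p E, k := IsLocalRing.ResidueField (intermediateFieldIntegers p E),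
            𝒟 := 𝒟, 𝓡 := 𝓡, φ := emb.comp (φ : 𝓡.R →+* intermediateFieldIntegers p E) }, ?_⟩
  refine ⟨hup, hdiag, hsc, hdist, hor, hS, T⁻¹ * Matrix.GeneralLinearGroup.map emb P, fun g => ?_⟩
  change Matrix.GeneralLinearGroup.map (emb.comp (φ : 𝓡.R →+* intermediateFieldIntegers p E)) (𝓡.ρ g) = _
  have h1 : Matrix.GeneralLinearGroup.map (φ : 𝓡.R →+* intermediateFieldIntegers p E) (𝓡.ρ g) =
      P⁻¹ * ρE g * P := by
    have := hP g
    rw [MonoidHom.comp_apply] at this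
    rw [this]; group
  rw [Matrix.GeneralLinearGroup.map_comp, MonoidHom.comp_apply, h1, map_mul, map_mul, map_inv, hρE g]
  group

end

end Summit.Langlands.Langlands.Cruxes.ReducibleOrdinaryProModular.SteinbergHyperplane
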